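import Mathlib
import HarnessLib
import Summits.Ventures.LatticeQCDFlow.Scaling.TorusAcceptanceSandwich2D
import Summits.Ventures.LatticeQCDFlow.Scaling.TorusEssLossSandwich2D
import Summits.Ventures.LatticeQCDFlow.Scaling.IdentityFlowAcceptanceDiagonalLimit
import Summits.Ventures.LatticeQCDFlow.Scaling.CumulantDiagonalLimit
import Summits.Ventures.LatticeQCDFlow.Scaling.TiltPiReindexCentring

/-!
# LatticeQCDFlow / Scaling — THE DIAGONAL ON THE TORUS: at `β_L√(L² − 1) = c` the untrained sampler of
# 2-d Wilson lattice gauge theory on the periodic `L × L` torus has, as `L → ∞`, acceptance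
# `→ erfc(|c|σ/2)`, ESS `→ e^{−c²σ²}` and reverse loss `→ c²σ²/2`, `σ² = Var_Haar(Re tr ρ)`, for every
# compact gauge group

HONEST FRAMING: exact (Metropolis-corrected) sampling algorithms for lattice gauge theory;
figures of merit are autocorrelation/cost numbers at stated couplings and volumes; no
continuum-physics claim.

Venture `LatticeQCDFlow` (cell pub-lqcd), topic `Scaling`; FANOUT row 3 (`s0-u1-a`, S0-B
implementation A: the 2-d flow sampler on the `16 × 16` torus, GEN-21).  NEW WORK of the cell, no
numerics, NO definition.  GEN-19/20 proved the large-volume laws of the untrained FACTORISED sampler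
(`n` independent plaquettes, coupling `c/√n`): acceptance `→ ∫∫ min(eˣ, eʸ) dN(−s/2, s)² = erfc(|c|σ/2)`
(`Scaling/IdentityFlowAcceptanceDiagonalLimit`), Kish ESS fraction `→ e^{−c²σ²}` and total reverse
loss `n·cgf(c/√n) → c²σ²/2` (`Scaling/CumulantDiagonalLimit`), `s = c²σ²`, and listed "the torus"
as NOT CLAIMED.  GEN-21's siblings `Scaling/TorusAcceptanceSandwich2D` / `TorusEssLossSandwich2D`
compare the periodic `L × L` torus with the factorised `(L² − 1)`-plaquette sampler up to the
volume-independent factors `e^{±4|β|N}`, `e^{±8|β|N}`, `±4|β|N`.  Along the diagonal of the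
punctured torus, `β_L = c/√(L² − 1)` (`L = k + 2`, `k → ∞`), those factors tend to one, the index
set `{x ≠ x₀}` is re-indexed by `Fin (L² − 1)` (a subsequence of GEN-19's `n`), the statistic
`Re tr ρ − N` is re-centred to `Re tr ρ − m` (the acceptance, ESS and loss functionals are blind to
constant shifts), and the factorised laws become TORUS laws:

* §1 `oneplaquette_integral_eq_exp_mul_mgf`, `oneplaquette_ratio_eq_mgf`, `oneplaquette_loss_eq_cgf`
  — centring: `z(β) = e^{β(m−N)}·M(β)`, `z(β)²/z(2β) = M(β)²/M(2β)`, `log z(β) + β(N − m) = cgf(β)`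
  for the centred statistic `Re tr ρ − m` under Haar;
* (sibling `Scaling/TiltPiReindexCentring`, imported: invariance of the factorised acceptance
  functional under re-indexing `ι ≃ Fin n` and under constant shifts of the statistic;
  `L² − 1 → ∞`, `β_L → 0`, sandwich factors `→ 1`);
* §2 **`torus_meanAccept_diag_tendsto`** (`→` the log-normal acceptance law, `s = c²σ²`),
  **`torus_meanAccept_diag_tendsto_erfc`** (`= (2/√π)∫_{√s/2}^∞ e^{−u²} du = erfc(|c|σ/2)`, `c ≠ 0`,
  `σ ≠ 0`), **`torus_essFrac_diag_tendsto`** (`→ e^{−c²σ²}`), **`torus_reverseKL_diag_tendsto`**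
  (`→ c²σ²/2`): GEN-19/20's dictionary `acc = erfc(√(D/2))`, `ESS = e^{−2D}` with `D = s/2` the
  limiting loss, now ON THE TORUS, for U(1), SU(N) and every compact gauge group at once.

Reading (value-free; no number of ours is computed or implied): for the cell's own object — the
periodic two-dimensional torus — the untrained exact sampler's three figures of merit have, in the
window `β√V = c`, exactly the universal large-volume profiles of the factorised model.  NOT CLAIMED:
the diagonal written as `β = c/L` and general sequences `β_L·L → c` (a monotone squeeze, staged with
GEN-20's `Scaling/AcceptanceAlongCouplingSequences`); rates; `d ≥ 3`; trained flows; the concrete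
variances `σ²_{U(1)} = 1/2`, `σ²_{SU(2)}` (row 3's one-plaquette files); any value at the cell's
`(β, L)`; nothing re-scored, SEALED.md untouched.
-/

noncomputable section

namespace Summit.Ventures.LatticeQCDFlow.Theory2

open MeasureTheory ProbabilityTheory Filter Finset Real Set
open Literature.MathematicalPhysics.QuantumFieldTheory
open Literature.Probability.Distributions.PseudoMarginalNoise
open scoped Topology NNReal

variable {L N : ℕ} {G : Type*} [Group G] [TopologicalSpace G] [IsTopologicalGroup G]
  [CompactSpace G] [SecondCountableTopology G] [MeasurableSpace G] [BorelSpace G]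
  (ρ : G →* Matrix (Fin N) (Fin N) ℂ)

/-! ## §1 Centring: the factorised quantities in cumulant vocabulary -/

section Centring

omit [SecondCountableTopology G] in
/-- `z(β) = e^{β(m − N)}·M(β)` with `M` the moment generating function of the CENTRED statistic
`Re tr ρ − m` under Haar. [ours] -/
theorem oneplaquette_integral_eq_exp_mul_mgf (β : ℝ) :
    ∫ g, Real.exp (β * ((ρ g).trace.re - N)) ∂(haarProbability G) =
      Real.exp (β * ((∫ g, (ρ g).trace.re ∂(haarProbability G)) - N)) *
        mgf (fun g => (ρ g).trace.re - ∫ g, (ρ g).trace.re ∂(haarProbability G))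
          (haarProbability G) β := by
  rw [mgf, ← integral_const_mul]
  refine integral_congr_ae (ae_of_all _ fun g => ?_)
  simp only
  rw [← Real.exp_add]
  congr 1
  ring

omit [SecondCountableTopology G] in
/-- **The factorised ESS rate is the centred Kish ratio**: `z(β)²/z(2β) = M(β)²/M(2β)`,
`M = mgf(Re tr ρ − m)` (GEN-19's `Scaling/CumulantDiagonalLimit` vocabulary). [ours] -/
theorem oneplaquette_ratio_eq_mgf (hρ : Continuous ρ) (β : ℝ) :
    (∫ g, Real.exp (β * ((ρ g).trace.re - N)) ∂(haarProbability G)) ^ 2 /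
        ∫ g, Real.exp (2 * β * ((ρ g).trace.re - N)) ∂(haarProbability G) =
      mgf (fun g => (ρ g).trace.re - ∫ g, (ρ g).trace.re ∂(haarProbability G))
            (haarProbability G) β ^ 2 /
        mgf (fun g => (ρ g).trace.re - ∫ g, (ρ g).trace.re ∂(haarProbability G))
          (haarProbability G) (2 * β) := by
  rw [oneplaquette_integral_eq_exp_mul_mgf ρ β, oneplaquette_integral_eq_exp_mul_mgf ρ (2 * β), mul_pow,
    ← Real.exp_nat_mul]
  have hM : 0 < mgf (fun g => (ρ g).trace.re - ∫ g, (ρ g).trace.re ∂(haarProbability G))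
      (haarProbability G) (2 * β) := by
    have h := oneplaquette_integral_pos ρ hρ (2 * β)
    rw [oneplaquette_integral_eq_exp_mul_mgf ρ (2 * β)] at h
    exact pos_of_mul_pos_right h (Real.exp_pos _).le
  rw [mul_div_mul_comm, show ((2 : ℕ) : ℝ) * (β * ((∫ g, (ρ g).trace.re ∂haarProbability G) - N))
      = 2 * β * ((∫ g, (ρ g).trace.re ∂haarProbability G) - N) by push_cast; ring,
    div_self (Real.exp_pos _).ne', one_mul]

omit [SecondCountableTopology G] in
/-- **The factorised per-plaquette reverse loss is the centred cumulant generating function**: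
`log z(β) + β(N − m) = cgf_{Re tr ρ − m}(β)` (GEN-20's `Scaling/TiltKLDivergence`: the reverse loss of
the tilt family is `cgf(t) − t·E X`, here with `E X = 0`). [ours] -/
theorem oneplaquette_loss_eq_cgf (hρ : Continuous ρ) (β : ℝ) :
    Real.log (∫ g, Real.exp (β * ((ρ g).trace.re - N)) ∂(haarProbability G)) +
        β * (N - ∫ g, (ρ g).trace.re ∂(haarProbability G)) =
      cgf (fun g => (ρ g).trace.re - ∫ g, (ρ g).trace.re ∂(haarProbability G))
        (haarProbability G) β := by
  have hM : 0 < mgf (fun g => (ρ g).trace.re - ∫ g, (ρ g).trace.re ∂(haarProbability G))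
      (haarProbability G) β := by
    have h := oneplaquette_integral_pos ρ hρ β
    rw [oneplaquette_integral_eq_exp_mul_mgf ρ β] at h
    exact pos_of_mul_pos_right h (Real.exp_pos _).le
  rw [oneplaquette_integral_eq_exp_mul_mgf ρ β, Real.log_mul (Real.exp_pos _).ne' hM.ne', Real.log_exp,
    cgf]
  ring

end Centring



/-! ## §2 The diagonal on the torus: acceptance, ESS and reverse loss -/

section Diagonal

omit [SecondCountableTopology G] in
/-- The centred one-plaquette statistic `Re tr ρ − m` under Haar: measurable, `|·| ≤ 2N`, mean zero,
and `Var = Var(Re tr ρ)`. [ours] -/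
theorem centredTrace_facts (hρ : Continuous ρ) :
    Measurable (fun g : G => (ρ g).trace.re - ∫ h, (ρ h).trace.re ∂(haarProbability G)) ∧
    (∀ g : G, |(ρ g).trace.re - ∫ h, (ρ h).trace.re ∂(haarProbability G)| ≤ 2 * N) ∧
    ∫ g, ((ρ g).trace.re - ∫ h, (ρ h).trace.re ∂(haarProbability G)) ∂(haarProbability G) = 0 ∧
    Var[fun g : G => (ρ g).trace.re - ∫ h, (ρ h).trace.re ∂(haarProbability G); haarProbability G] =
      Var[fun g : G => (ρ g).trace.re; haarProbability G] := by
  have hr : Continuous fun g : G => (ρ g).trace.re := Complex.continuous_re.comp hρ.matrix_trace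
  have hb : ∀ g, |(ρ g).trace.re| ≤ N := fun g => by
    have h := Literature.RepresentationTheory.CompactGroups.CompactGroup.abs_re_trace_le_card ρ hρ g
    rwa [Fintype.card_fin] at h
  have hri : Integrable (fun g : G => (ρ g).trace.re) (haarProbability G) :=
    Integrable.of_mem_Icc (-(N : ℝ)) N hr.measurable.aemeasurable (ae_of_all _ fun g => abs_le.1 (hb g))
  have hm : |∫ h, (ρ h).trace.re ∂(haarProbability G)| ≤ N := by
    refine (abs_integral_le_integral_abs).trans ?_
    calc ∫ g, |(ρ g).trace.re| ∂(haarProbability G) ≤ ∫ _g, (N : ℝ) ∂(haarProbability G) :=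
          integral_mono_of_nonneg (ae_of_all _ fun g => abs_nonneg _) (integrable_const _)
            (ae_of_all _ fun g => hb g)
      _ = N := by rw [integral_const, probReal_univ, one_smul]
  refine ⟨(hr.sub continuous_const).measurable, fun g => ?_, ?_, variance_sub_const hr.aestronglyMeasurable _⟩
  · calc |(ρ g).trace.re - ∫ h, (ρ h).trace.re ∂(haarProbability G)|
        ≤ |(ρ g).trace.re| + |∫ h, (ρ h).trace.re ∂(haarProbability G)| := abs_sub _ _
      _ ≤ N + N := add_le_add (hb g) hm
      _ = 2 * N := by ring
  · rw [integral_sub hri (integrable_const _), integral_const, probReal_univ, one_smul, sub_self]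

/-- **THE DIAGONAL ACCEPTANCE LAW ON THE TORUS.**  For every compact second-countable gauge group `G`,
continuous `ρ` and real `c`: at coupling `β_L = c/√(L² − 1)` the equilibrium acceptance of the
untrained exact sampler of 2-d Wilson lattice gauge theory on the periodic `L × L` torus converges,
as `L = k + 2 → ∞`, to the log-normal acceptance law `∫∫ min(eˣ, eʸ) dN(−s/2, s)²`,
`s = c²·Var_Haar(Re tr ρ)` — GEN-19's `tiltPi_meanAccept_diag_tendsto`, transferred to the torus by
`torus_meanAccept_sandwich`. [ours] -/
theorem torus_meanAccept_diag_tendsto (hρ : Continuous ρ) (c : ℝ) :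
    Tendsto (fun k : ℕ =>
        ∫ U, ∫ U', min
            (Real.exp (-(c / Real.sqrt ((((k + 2) ^ 2 - 1 : ℕ)) : ℝ)) * wilsonAction ρ U) /
              ∫ V, Real.exp (-(c / Real.sqrt ((((k + 2) ^ 2 - 1 : ℕ)) : ℝ)) * wilsonAction ρ V)
                ∂(Measure.pi fun _ : Edge 2 (k + 2) => haarProbability G))
            (Real.exp (-(c / Real.sqrt ((((k + 2) ^ 2 - 1 : ℕ)) : ℝ)) * wilsonAction ρ U') /
              ∫ V, Real.exp (-(c / Real.sqrt ((((k + 2) ^ 2 - 1 : ℕ)) : ℝ)) * wilsonAction ρ V)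
                ∂(Measure.pi fun _ : Edge 2 (k + 2) => haarProbability G))
          ∂(Measure.pi fun _ : Edge 2 (k + 2) => haarProbability G)
          ∂(Measure.pi fun _ : Edge 2 (k + 2) => haarProbability G))
      atTop (𝓝 (∫ x, ∫ y, min (Real.exp x) (Real.exp y)
        ∂(noiseLaw (c ^ 2 * Var[fun g : G => (ρ g).trace.re; haarProbability G]).toNNReal)
        ∂(noiseLaw (c ^ 2 * Var[fun g : G => (ρ g).trace.re; haarProbability G]).toNNReal))) := by
  obtain ⟨hXm, hXb, hX0, hVar⟩ := centredTrace_facts ρ hρ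
  set m : ℝ := ∫ h, (ρ h).trace.re ∂(haarProbability G) with hm
  -- GEN-19's law for the centred statistic along the subsequence `n_k = (k+2)² − 1`
  have hD := ((tiltPi_meanAccept_diag_tendsto (ν := haarProbability G)
    (g := fun g => (ρ g).trace.re - m) hXm hXb hX0 c).comp tendsto_puncturedVolume_atTop)
  rw [hVar] at hD
  have hβ := tendsto_diagCoupling_zero c
  -- the per-`k` sandwich, re-centred and re-indexed
  have hk : ∀ k : ℕ,
      (∫ z, ∫ z', min (Real.exp (c / Real.sqrt ((((k + 2) ^ 2 - 1 : ℕ)) : ℝ) * ∑ i, ((ρ (z i)).trace.re - m)))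
            (Real.exp (c / Real.sqrt ((((k + 2) ^ 2 - 1 : ℕ)) : ℝ) * ∑ i, ((ρ (z' i)).trace.re - m)))
          ∂(Measure.pi fun _ : Fin ((k + 2) ^ 2 - 1) => haarProbability G)
          ∂(Measure.pi fun _ : Fin ((k + 2) ^ 2 - 1) => haarProbability G)) /
        ∫ z, Real.exp (c / Real.sqrt ((((k + 2) ^ 2 - 1 : ℕ)) : ℝ) * ∑ i, ((ρ (z i)).trace.re - m))
          ∂(Measure.pi fun _ : Fin ((k + 2) ^ 2 - 1) => haarProbability G) =
      (∫ y, ∫ y', min (Real.exp (c / Real.sqrt ((((k + 2) ^ 2 - 1 : ℕ)) : ℝ) *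
              ∑ x, ((ρ (y x)).trace.re - N)))
            (Real.exp (c / Real.sqrt ((((k + 2) ^ 2 - 1 : ℕ)) : ℝ) * ∑ x, ((ρ (y' x)).trace.re - N)))
          ∂(Measure.pi fun _ : {x : Site 2 (k + 2) // x ≠ 0} => haarProbability G)
          ∂(Measure.pi fun _ : {x : Site 2 (k + 2) // x ≠ 0} => haarProbability G)) /
        ∫ y, Real.exp (c / Real.sqrt ((((k + 2) ^ 2 - 1 : ℕ)) : ℝ) * ∑ x, ((ρ (y x)).trace.re - N))
          ∂(Measure.pi fun _ : {x : Site 2 (k + 2) // x ≠ 0} => haarProbability G) := by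
    intro k
    have e : {x : Site 2 (k + 2) // x ≠ 0} ≃ Fin ((k + 2) ^ 2 - 1) :=
      Fintype.equivFinOfCardEq (card_site_ne 0)
    rw [← tiltPi_ratio_reindex (haarProbability G) e (fun g => (ρ g).trace.re - m)]
    have hsh := tiltPi_ratio_add_const (ι := {x : Site 2 (k + 2) // x ≠ 0}) (haarProbability G)
      (fun g => (ρ g).trace.re - m) (m - N) (c / Real.sqrt ((((k + 2) ^ 2 - 1 : ℕ)) : ℝ))
    simp only [sub_add_sub_cancel] at hsh
    exact hsh.symm
  have hsw : ∀ k : ℕ, 2 ≤ k + 2 := fun k => by omega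
  have hlo := (tendsto_exp_neg_mul_abs_one hβ 4 N).mul hD
  have hhi := (tendsto_exp_mul_abs_one hβ 4 N).mul hD
  rw [one_mul] at hlo hhi
  refine tendsto_of_tendsto_of_tendsto_of_le_of_le hlo hhi (fun k => ?_) (fun k => ?_)
  · have h := (torus_meanAccept_sandwich ρ (hsw k) (0 : Site 2 (k + 2)) hρ
      (c / Real.sqrt ((((k + 2) ^ 2 - 1 : ℕ)) : ℝ))).1
    rw [← hk k] at h
    simpa only [one_mul, Function.comp_apply] using h
  · have h := (torus_meanAccept_sandwich ρ (hsw k) (0 : Site 2 (k + 2)) hρ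
      (c / Real.sqrt ((((k + 2) ^ 2 - 1 : ℕ)) : ℝ))).2
    rw [← hk k] at h
    simpa only [one_mul, Function.comp_apply] using h

/-- **THE DIAGONAL PROFILE ON THE TORUS IS `erfc(|c|σ/2)`**: for `c ≠ 0` and `Var_Haar(Re tr ρ) ≠ 0`
the limit is `(2/√π)∫_{√(c²σ²)/2}^∞ e^{−u²} du` (the flow seat's `imh_lognormal_accRate_eq_erfc`). [ours] -/
theorem torus_meanAccept_diag_tendsto_erfc (hρ : Continuous ρ) {c : ℝ} (hc : c ≠ 0)
    (hσ : Var[fun g : G => (ρ g).trace.re; haarProbability G] ≠ 0) :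
    Tendsto (fun k : ℕ =>
        ∫ U, ∫ U', min
            (Real.exp (-(c / Real.sqrt ((((k + 2) ^ 2 - 1 : ℕ)) : ℝ)) * wilsonAction ρ U) /
              ∫ V, Real.exp (-(c / Real.sqrt ((((k + 2) ^ 2 - 1 : ℕ)) : ℝ)) * wilsonAction ρ V)
                ∂(Measure.pi fun _ : Edge 2 (k + 2) => haarProbability G))
            (Real.exp (-(c / Real.sqrt ((((k + 2) ^ 2 - 1 : ℕ)) : ℝ)) * wilsonAction ρ U') /
              ∫ V, Real.exp (-(c / Real.sqrt ((((k + 2) ^ 2 - 1 : ℕ)) : ℝ)) * wilsonAction ρ V)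
                ∂(Measure.pi fun _ : Edge 2 (k + 2) => haarProbability G))
          ∂(Measure.pi fun _ : Edge 2 (k + 2) => haarProbability G)
          ∂(Measure.pi fun _ : Edge 2 (k + 2) => haarProbability G))
      atTop (𝓝 (2 / Real.sqrt Real.pi *
        ∫ u in Ioi (Real.sqrt (c ^ 2 * Var[fun g : G => (ρ g).trace.re; haarProbability G]) / 2),
          Real.exp (-u ^ 2))) := by
  have hpos : 0 < c ^ 2 * Var[fun g : G => (ρ g).trace.re; haarProbability G] :=
    mul_pos (by positivity) (lt_of_le_of_ne (variance_nonneg _ _) (Ne.symm hσ))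
  have hs : (c ^ 2 * Var[fun g : G => (ρ g).trace.re; haarProbability G]).toNNReal ≠ 0 := fun h =>
    absurd (Real.toNNReal_eq_zero.1 h) (not_le.2 hpos)
  have h := torus_meanAccept_diag_tendsto ρ hρ c
  rw [Scoring.imh_lognormal_accRate_eq_erfc hs, Real.coe_toNNReal _ hpos.le] at h
  exact h

/-- **THE DIAGONAL ESS LAW ON THE TORUS**: at `β_L = c/√(L² − 1)` the Kish fraction `(∫p)²/∫p²` of the
untrained sampler on the periodic `L × L` torus tends to `e^{−c²σ²}`, `σ² = Var_Haar(Re tr ρ)` — GEN-19's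
`tendsto_essFrac_diag`, transferred by `torus_essFrac_sandwich`. [ours] -/
theorem torus_essFrac_diag_tendsto (hρ : Continuous ρ) (c : ℝ) :
    Tendsto (fun k : ℕ =>
        (∫ U, Real.exp (-(c / Real.sqrt ((((k + 2) ^ 2 - 1 : ℕ)) : ℝ)) * wilsonAction ρ U) /
              ∫ V, Real.exp (-(c / Real.sqrt ((((k + 2) ^ 2 - 1 : ℕ)) : ℝ)) * wilsonAction ρ V)
                ∂(Measure.pi fun _ : Edge 2 (k + 2) => haarProbability G)
            ∂(Measure.pi fun _ : Edge 2 (k + 2) => haarProbability G)) ^ 2 /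
          ∫ U, (Real.exp (-(c / Real.sqrt ((((k + 2) ^ 2 - 1 : ℕ)) : ℝ)) * wilsonAction ρ U) /
              ∫ V, Real.exp (-(c / Real.sqrt ((((k + 2) ^ 2 - 1 : ℕ)) : ℝ)) * wilsonAction ρ V)
                ∂(Measure.pi fun _ : Edge 2 (k + 2) => haarProbability G)) ^ 2
            ∂(Measure.pi fun _ : Edge 2 (k + 2) => haarProbability G))
      atTop (𝓝 (Real.exp (-(c ^ 2 * Var[fun g : G => (ρ g).trace.re; haarProbability G])))) := by
  obtain ⟨hXm, hXb, hX0, hVar⟩ := centredTrace_facts ρ hρ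
  set m : ℝ := ∫ h, (ρ h).trace.re ∂(haarProbability G) with hm
  have hXb' : ∀ᵐ g ∂(haarProbability G), (ρ g).trace.re - m ∈ Set.Icc (-(2 * (N : ℝ))) (2 * N) :=
    ae_of_all _ fun g => abs_le.1 (hXb g)
  have hE := ((tendsto_essFrac_diag (μ := haarProbability G) (X := fun g => (ρ g).trace.re - m)
    hXm.aemeasurable hXb' hX0 c).comp tendsto_puncturedVolume_atTop)
  rw [hVar] at hE
  have hβ := tendsto_diagCoupling_zero c
  have hsw : ∀ k : ℕ, 2 ≤ k + 2 := fun k => by omega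
  -- the factorised rate in cumulant vocabulary
  have hk : ∀ k : ℕ,
      ((∫ g, Real.exp (c / Real.sqrt ((((k + 2) ^ 2 - 1 : ℕ)) : ℝ) * ((ρ g).trace.re - N))
            ∂(haarProbability G)) ^ 2 /
          ∫ g, Real.exp (2 * (c / Real.sqrt ((((k + 2) ^ 2 - 1 : ℕ)) : ℝ)) * ((ρ g).trace.re - N))
            ∂(haarProbability G)) ^ ((k + 2) ^ 2 - 1) =
      (mgf (fun g => (ρ g).trace.re - m) (haarProbability G) (c / Real.sqrt ((((k + 2) ^ 2 - 1 : ℕ)) : ℝ)) ^ 2 /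
        mgf (fun g => (ρ g).trace.re - m) (haarProbability G)
          (2 * c / Real.sqrt ((((k + 2) ^ 2 - 1 : ℕ)) : ℝ))) ^ ((k + 2) ^ 2 - 1) := by
    intro k
    rw [oneplaquette_ratio_eq_mgf ρ hρ, mul_div_assoc]
  have hlo := (tendsto_exp_neg_mul_abs_one hβ 8 N).mul hE
  have hhi := (tendsto_exp_mul_abs_one hβ 8 N).mul hE
  rw [one_mul] at hlo hhi
  refine tendsto_of_tendsto_of_tendsto_of_le_of_le hlo hhi (fun k => ?_) (fun k => ?_)
  · have h := (torus_essFrac_sandwich ρ (hsw k) hρ (c / Real.sqrt ((((k + 2) ^ 2 - 1 : ℕ)) : ℝ))).1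
    rw [hk k] at h
    simpa only [Function.comp_apply] using h
  · have h := (torus_essFrac_sandwich ρ (hsw k) hρ (c / Real.sqrt ((((k + 2) ^ 2 - 1 : ℕ)) : ℝ))).2
    rw [hk k] at h
    simpa only [Function.comp_apply] using h

/-- **THE DIAGONAL LOSS LAW ON THE TORUS**: at `β_L = c/√(L² − 1)` the reverse Kullback–Leibler
divergence `D(Haar^{⊗E} ‖ Wilson_{β_L}) = ∫ log(1/p) dHaar^{⊗E}` of the untrained sampler on the
periodic `L × L` torus tends to `c²σ²/2`, `σ² = Var_Haar(Re tr ρ)` — GEN-19's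
`tendsto_nat_mul_cgf_div_sqrt` (the total loss of the factorised sampler), transferred by
`torus_reverseKL_sandwich`.  With the two theorems above: `ESS → e^{−2D}`, `acc → erfc(√(D/2))`,
`D = c²σ²/2` — the loss dictionary ON THE TORUS. [ours] -/
theorem torus_reverseKL_diag_tendsto (hρ : Continuous ρ) (c : ℝ) :
    Tendsto (fun k : ℕ =>
        ∫ U, Real.log (1 / (Real.exp (-(c / Real.sqrt ((((k + 2) ^ 2 - 1 : ℕ)) : ℝ)) * wilsonAction ρ U) /
            ∫ V, Real.exp (-(c / Real.sqrt ((((k + 2) ^ 2 - 1 : ℕ)) : ℝ)) * wilsonAction ρ V)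
              ∂(Measure.pi fun _ : Edge 2 (k + 2) => haarProbability G)))
          ∂(Measure.pi fun _ : Edge 2 (k + 2) => haarProbability G))
      atTop (𝓝 (c ^ 2 * Var[fun g : G => (ρ g).trace.re; haarProbability G] / 2)) := by
  obtain ⟨hXm, hXb, hX0, hVar⟩ := centredTrace_facts ρ hρ
  set m : ℝ := ∫ h, (ρ h).trace.re ∂(haarProbability G) with hm
  have hXb' : ∀ᵐ g ∂(haarProbability G), (ρ g).trace.re - m ∈ Set.Icc (-(2 * (N : ℝ))) (2 * N) :=
    ae_of_all _ fun g => abs_le.1 (hXb g)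
  have hC := ((tendsto_nat_mul_cgf_div_sqrt (μ := haarProbability G) (X := fun g => (ρ g).trace.re - m)
    hXm.aemeasurable hXb' hX0 c).comp tendsto_puncturedVolume_atTop)
  rw [hVar] at hC
  have hβ := tendsto_diagCoupling_zero c
  have hsw : ∀ k : ℕ, 2 ≤ k + 2 := fun k => by omega
  have hδ : Tendsto (fun k : ℕ => 4 * |c / Real.sqrt ((((k + 2) ^ 2 - 1 : ℕ)) : ℝ)| * (N : ℝ)) atTop
      (𝓝 0) := by
    have h : Tendsto (fun k : ℕ => 4 * |c / Real.sqrt ((((k + 2) ^ 2 - 1 : ℕ)) : ℝ)| * (N : ℝ)) atTop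
        (𝓝 (4 * |(0 : ℝ)| * N)) := (hβ.abs.const_mul 4).mul_const (N : ℝ)
    rwa [abs_zero, mul_zero, zero_mul] at h
  have hlo := hC.sub hδ
  have hhi := hC.add hδ
  rw [sub_zero] at hlo
  rw [add_zero] at hhi
  refine tendsto_of_tendsto_of_tendsto_of_le_of_le hlo hhi (fun k => ?_) (fun k => ?_)
  · have h := abs_le.1 (torus_reverseKL_sandwich ρ (hsw k) hρ (c / Real.sqrt ((((k + 2) ^ 2 - 1 : ℕ)) : ℝ)))
    rw [oneplaquette_loss_eq_cgf ρ hρ] at h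
    simp only [Function.comp_apply]
    linarith [h.1]
  · have h := abs_le.1 (torus_reverseKL_sandwich ρ (hsw k) hρ (c / Real.sqrt ((((k + 2) ^ 2 - 1 : ℕ)) : ℝ)))
    rw [oneplaquette_loss_eq_cgf ρ hρ] at h
    simp only [Function.comp_apply]
    linarith [h.2]

end Diagonal

end Summit.Ventures.LatticeQCDFlow.Theory2

end
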